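import Summits.Ventures.Crystal3D.Theorems.StickyWulffConstantNoReconstructionGainCubicActions
import Summits.Ventures.Crystal3D.Theses.StickyWulffConstant
import HarnessLib

/-!
# A fundamental domain of normals for `NoReconstructionGain`

HONEST FRAMING. Part of the venture `Summits/Ventures/Crystal3D` (cell `crystal3d-full`), helper
`--supports` the crux `NoReconstructionGain` (stmt-Ventures-19144, route
`route-Ventures-StickyWulffConstant`), line `adhesion`; built on `…NoReconstructionGainSymmetry`
(transport of the crux body along the lattice isometries of `Λ₀ = fccStacking 1 √(2/3)`) and
`…NoReconstructionGainCubicActions` (the generators act on the cubic coordinates by signed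
permutations).  Here the 48 symmetries are put to use: EVERY normal `ν` is carried by a lattice
isometry into the closed cone

  `T = {ν : 0 ≤ ν₀, ν₀ ≤ √3 ν₁, ν₀ + (√3/3) ν₁ ≤ √(2/3) ν₂}`

(`exists_latticeIsometry_mem_chamber`), whose unit vectors form the spherical triangle with vertices
the basal normal `e₃` (a `(111)` direction), the bond direction `t = (1/2, √3/6, √(2/3))` (a `(110)`
direction) and the cube normal `(0, √6/3, √3/3)` (a `(100)` direction); its sides lie on the mirrors
orthogonal to the bonds `u = (1,0,0)` and `u − v = (1/2, −√3/2, 0)` and on the cube mirror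
`ν₀ + (√3/3)ν₁ = √(2/3)ν₂`.  Consequently:

* `noReconstructionGain_of_chamber` — if the body of the crux holds, with one pair of constants
  `(R, C)`, at every unit normal in `T`, then `NoReconstructionGain` holds (the crux BY NAME; a
  REDUCTION, recorded by the audit as conditional on the restricted body);
* `adhesion_of_chamber` — the same reduction for the line's registered atom `stub_adhesion`.

Mechanism: sign repair (`exists_latticeIsometry_cubic_nonneg`) followed by sorting
(`exists_latticeIsometry_cubic_sorted`) lands the cubic coordinates in `{0 ≤ A ≤ B ≤ C}`, and the
signed move `−1 ∘ r_t ∘ r_{u−v}` in `T = {0 ≤ −A ≤ B ≤ C}`.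

WHAT THIS IS NOT: a proof of any case of the atom; rung F-C1 not moved.
-/

noncomputable section

namespace Summit.Ventures.Crystal3D.Theorems

open Summit.Ventures.Crystal3D Finset
open Literature.MathematicalPhysics.StatisticalMechanics (barlowPos barlowStacking fccStacking
  constHagg barlowPos_mem haggLabel_const barlowPos_apply_zero barlowPos_apply_one
  barlowPos_apply_two orderedContacts contactDeficiency)
open scoped InnerProductSpace

/-! ### Reduction to the chamber -/

/-- Step 1 — signs: some lattice isometry makes all three cubic coordinates non-negative. -/
theorem exists_latticeIsometry_cubic_nonneg (A B C : EuclideanSpace ℝ (Fin 3) → ℝ)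
    (hA : ∀ x, A x = x 0 + Real.sqrt 3 / 3 * x 1 - Real.sqrt (2 / 3) * x 2)
    (hB : ∀ x, B x = x 0 - Real.sqrt 3 / 3 * x 1 + Real.sqrt (2 / 3) * x 2)
    (hC : ∀ x, C x = 2 * Real.sqrt 3 / 3 * x 1 + Real.sqrt (2 / 3) * x 2)
    (ν : EuclideanSpace ℝ (Fin 3)) :
    ∃ g : EuclideanSpace ℝ (Fin 3) ≃ₗᵢ[ℝ] EuclideanSpace ℝ (Fin 3),
      ((∀ p ∈ fccStacking 1 (Real.sqrt (2 / 3)), g p ∈ fccStacking 1 (Real.sqrt (2 / 3))) ∧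
        (∀ p ∈ fccStacking 1 (Real.sqrt (2 / 3)), g.symm p ∈ fccStacking 1 (Real.sqrt (2 / 3)))) ∧
      0 ≤ A (g ν) ∧ 0 ≤ B (g ν) ∧ 0 ≤ C (g ν) := by
  obtain ⟨⟨huΛ, hun⟩, ⟨hvΛ, hvn⟩, ⟨htΛ, htn⟩, -, -, -⟩ := bond_mem_and_norm
  have Gu := latticeIsometry_bondReflection huΛ hun
  have Gv := latticeIsometry_bondReflection hvΛ hvn
  have Gt := latticeIsometry_bondReflection htΛ htn
  obtain ⟨⟨u1, u2, u3⟩, ⟨v1, v2, v3⟩, ⟨t1, t2, t3⟩, -, -, -, -⟩ := cubic_actions A B C hA hB hC ν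
  have hneg := fun y => (cubic_actions A B C hA hB hC y).2.2.2.2.2.2
  rcases le_or_gt 0 (A ν) with ha | ha <;> rcases le_or_gt 0 (B ν) with hb | hb <;>
    rcases le_or_gt 0 (C ν) with hc | hc
  · exact ⟨_, latticeIsometry_refl, ha, hb, hc⟩
  · -- (+,+,−): `−1 ∘ r_u`
    refine ⟨(((ℝ ∙ barlowPos 1 (Real.sqrt (2 / 3)) constHagg 0 1 0)ᗮ).reflection).trans
      (LinearIsometryEquiv.neg ℝ), latticeIsometry_trans Gu latticeIsometry_neg, ?_⟩
    obtain ⟨f1, f2, f3⟩ := hneg ((ℝ ∙ barlowPos 1 (Real.sqrt (2 / 3)) constHagg 0 1 0)ᗮ.reflection ν)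
    rw [LinearIsometryEquiv.trans_apply, f1, f2, f3, u1, u2, u3]
    exact ⟨by linarith, by linarith, by linarith⟩
  · -- (+,−,+): `−1 ∘ r_v`
    refine ⟨(((ℝ ∙ barlowPos 1 (Real.sqrt (2 / 3)) constHagg 0 0 1)ᗮ).reflection).trans
      (LinearIsometryEquiv.neg ℝ), latticeIsometry_trans Gv latticeIsometry_neg, ?_⟩
    obtain ⟨f1, f2, f3⟩ := hneg ((ℝ ∙ barlowPos 1 (Real.sqrt (2 / 3)) constHagg 0 0 1)ᗮ.reflection ν)
    rw [LinearIsometryEquiv.trans_apply, f1, f2, f3, v1, v2, v3]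
    exact ⟨by linarith, by linarith, by linarith⟩
  · -- (+,−,−): `r_t`
    refine ⟨(ℝ ∙ barlowPos 1 (Real.sqrt (2 / 3)) constHagg 1 0 0)ᗮ.reflection, Gt, ?_⟩
    rw [t1, t2, t3]
    exact ⟨by linarith, by linarith, by linarith⟩
  · -- (−,+,+): `−1 ∘ r_t`
    refine ⟨(((ℝ ∙ barlowPos 1 (Real.sqrt (2 / 3)) constHagg 1 0 0)ᗮ).reflection).trans
      (LinearIsometryEquiv.neg ℝ), latticeIsometry_trans Gt latticeIsometry_neg, ?_⟩
    obtain ⟨f1, f2, f3⟩ := hneg ((ℝ ∙ barlowPos 1 (Real.sqrt (2 / 3)) constHagg 1 0 0)ᗮ.reflection ν)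
    rw [LinearIsometryEquiv.trans_apply, f1, f2, f3, t1, t2, t3]
    exact ⟨by linarith, by linarith, by linarith⟩
  · -- (−,+,−): `r_v`
    refine ⟨(ℝ ∙ barlowPos 1 (Real.sqrt (2 / 3)) constHagg 0 0 1)ᗮ.reflection, Gv, ?_⟩
    rw [v1, v2, v3]
    exact ⟨by linarith, by linarith, by linarith⟩
  · -- (−,−,+): `r_u`
    refine ⟨(ℝ ∙ barlowPos 1 (Real.sqrt (2 / 3)) constHagg 0 1 0)ᗮ.reflection, Gu, ?_⟩
    rw [u1, u2, u3]
    exact ⟨by linarith, by linarith, by linarith⟩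
  · -- (−,−,−): `−1`
    refine ⟨LinearIsometryEquiv.neg ℝ, latticeIsometry_neg, ?_⟩
    obtain ⟨f1, f2, f3⟩ := hneg ν
    rw [f1, f2, f3]
    exact ⟨by linarith, by linarith, by linarith⟩

/-- Step 2 — sorting: non-negative cubic coordinates are put in increasing order by a lattice
isometry. -/
theorem exists_latticeIsometry_cubic_sorted (A B C : EuclideanSpace ℝ (Fin 3) → ℝ)
    (hA : ∀ x, A x = x 0 + Real.sqrt 3 / 3 * x 1 - Real.sqrt (2 / 3) * x 2)
    (hB : ∀ x, B x = x 0 - Real.sqrt 3 / 3 * x 1 + Real.sqrt (2 / 3) * x 2)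
    (hC : ∀ x, C x = 2 * Real.sqrt 3 / 3 * x 1 + Real.sqrt (2 / 3) * x 2)
    (x : EuclideanSpace ℝ (Fin 3)) (ha : 0 ≤ A x) (hb : 0 ≤ B x) (hc : 0 ≤ C x) :
    ∃ g : EuclideanSpace ℝ (Fin 3) ≃ₗᵢ[ℝ] EuclideanSpace ℝ (Fin 3),
      ((∀ p ∈ fccStacking 1 (Real.sqrt (2 / 3)), g p ∈ fccStacking 1 (Real.sqrt (2 / 3))) ∧
        (∀ p ∈ fccStacking 1 (Real.sqrt (2 / 3)), g.symm p ∈ fccStacking 1 (Real.sqrt (2 / 3)))) ∧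
      0 ≤ A (g x) ∧ A (g x) ≤ B (g x) ∧ B (g x) ≤ C (g x) := by
  obtain ⟨-, -, -, ⟨huvΛ, huvn⟩, ⟨hutΛ, hutn⟩, ⟨hvtΛ, hvtn⟩⟩ := bond_mem_and_norm
  have Guv := latticeIsometry_bondReflection huvΛ huvn
  have Gut := latticeIsometry_bondReflection hutΛ hutn
  have Gvt := latticeIsometry_bondReflection hvtΛ hvtn
  obtain ⟨-, -, -, ⟨p1, p2, p3⟩, ⟨q1, q2, q3⟩, ⟨r1, r2, r3⟩, -⟩ := cubic_actions A B C hA hB hC x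
  have huv := fun y => (cubic_actions A B C hA hB hC y).2.2.2.1
  have hvt := fun y => (cubic_actions A B C hA hB hC y).2.2.2.2.2.1
  rcases le_total (A x) (B x) with hab | hab <;> rcases le_total (B x) (C x) with hbc | hbc
  · exact ⟨_, latticeIsometry_refl, ha, hab, hbc⟩
  · rcases le_total (A x) (C x) with hac | hac
    · -- A ≤ C ≤ B: swap `B, C`
      refine ⟨(ℝ ∙ (barlowPos 1 (Real.sqrt (2 / 3)) constHagg 0 1 0 -
        barlowPos 1 (Real.sqrt (2 / 3)) constHagg 0 0 1))ᗮ.reflection, Guv, ?_⟩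
      rw [p1, p2, p3]; exact ⟨ha, hac, hbc⟩
    · -- C ≤ A ≤ B: to (C, A, B) — swap `B,C` then swap `A,B`
      refine ⟨((ℝ ∙ (barlowPos 1 (Real.sqrt (2 / 3)) constHagg 0 1 0 -
          barlowPos 1 (Real.sqrt (2 / 3)) constHagg 0 0 1))ᗮ.reflection).trans
        ((ℝ ∙ (barlowPos 1 (Real.sqrt (2 / 3)) constHagg 0 0 1 -
          barlowPos 1 (Real.sqrt (2 / 3)) constHagg 1 0 0))ᗮ.reflection),
        latticeIsometry_trans Guv Gvt, ?_⟩
      obtain ⟨f1, f2, f3⟩ := hvt ((ℝ ∙ (barlowPos 1 (Real.sqrt (2 / 3)) constHagg 0 1 0 -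
          barlowPos 1 (Real.sqrt (2 / 3)) constHagg 0 0 1))ᗮ.reflection x)
      rw [LinearIsometryEquiv.trans_apply, f1, f2, f3, p1, p2, p3]
      exact ⟨hc, hac, hab⟩
  · rcases le_total (A x) (C x) with hac | hac
    · -- B ≤ A ≤ C: swap `A, B`
      refine ⟨(ℝ ∙ (barlowPos 1 (Real.sqrt (2 / 3)) constHagg 0 0 1 -
        barlowPos 1 (Real.sqrt (2 / 3)) constHagg 1 0 0))ᗮ.reflection, Gvt, ?_⟩
      rw [r1, r2, r3]; exact ⟨hb, hab, hac⟩
    · -- B ≤ C ≤ A: to (B, C, A) — swap `A,B` then swap `B,C`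
      refine ⟨((ℝ ∙ (barlowPos 1 (Real.sqrt (2 / 3)) constHagg 0 0 1 -
          barlowPos 1 (Real.sqrt (2 / 3)) constHagg 1 0 0))ᗮ.reflection).trans
        ((ℝ ∙ (barlowPos 1 (Real.sqrt (2 / 3)) constHagg 0 1 0 -
          barlowPos 1 (Real.sqrt (2 / 3)) constHagg 0 0 1))ᗮ.reflection),
        latticeIsometry_trans Gvt Guv, ?_⟩
      obtain ⟨f1, f2, f3⟩ := huv ((ℝ ∙ (barlowPos 1 (Real.sqrt (2 / 3)) constHagg 0 0 1 -
          barlowPos 1 (Real.sqrt (2 / 3)) constHagg 1 0 0))ᗮ.reflection x)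
      rw [LinearIsometryEquiv.trans_apply, f1, f2, f3, r1, r2, r3]
      exact ⟨hb, hbc, hac⟩
  · -- B ≤ A and C ≤ B: to (C, B, A) — swap `A, C`
    refine ⟨(ℝ ∙ (barlowPos 1 (Real.sqrt (2 / 3)) constHagg 0 1 0 -
      barlowPos 1 (Real.sqrt (2 / 3)) constHagg 1 0 0))ᗮ.reflection, Gut, ?_⟩
    rw [q1, q2, q3]; exact ⟨hc, hbc, hab⟩

/-- **Every normal has a lattice-symmetric copy in the fundamental triangle**
`T = {0 ≤ ν₀, ν₀ ≤ √3 ν₁, ν₀ + (√3/3) ν₁ ≤ √(2/3) ν₂}`. -/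
theorem exists_latticeIsometry_mem_chamber (ν : EuclideanSpace ℝ (Fin 3)) :
    ∃ g : EuclideanSpace ℝ (Fin 3) ≃ₗᵢ[ℝ] EuclideanSpace ℝ (Fin 3),
      ((∀ p ∈ fccStacking 1 (Real.sqrt (2 / 3)), g p ∈ fccStacking 1 (Real.sqrt (2 / 3))) ∧
        (∀ p ∈ fccStacking 1 (Real.sqrt (2 / 3)), g.symm p ∈ fccStacking 1 (Real.sqrt (2 / 3)))) ∧
      0 ≤ g ν 0 ∧ g ν 0 ≤ Real.sqrt 3 * g ν 1 ∧
        g ν 0 + Real.sqrt 3 / 3 * g ν 1 ≤ Real.sqrt (2 / 3) * g ν 2 := by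
  have h3 : Real.sqrt 3 ^ 2 = 3 := Real.sq_sqrt (by norm_num)
  have h3pos : 0 < Real.sqrt 3 := Real.sqrt_pos.2 (by norm_num)
  -- opaque cubic coordinates
  obtain ⟨A, hA⟩ : ∃ A : EuclideanSpace ℝ (Fin 3) → ℝ,
      ∀ x, A x = x 0 + Real.sqrt 3 / 3 * x 1 - Real.sqrt (2 / 3) * x 2 := ⟨_, fun x => rfl⟩
  obtain ⟨B, hB⟩ : ∃ B : EuclideanSpace ℝ (Fin 3) → ℝ,
      ∀ x, B x = x 0 - Real.sqrt 3 / 3 * x 1 + Real.sqrt (2 / 3) * x 2 := ⟨_, fun x => rfl⟩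
  obtain ⟨C, hC⟩ : ∃ C : EuclideanSpace ℝ (Fin 3) → ℝ,
      ∀ x, C x = 2 * Real.sqrt 3 / 3 * x 1 + Real.sqrt (2 / 3) * x 2 := ⟨_, fun x => rfl⟩
  obtain ⟨g₁, hG₁, ha₁, hb₁, hc₁⟩ := exists_latticeIsometry_cubic_nonneg A B C hA hB hC ν
  obtain ⟨g₂, hG₂, ha₂, hab₂, hbc₂⟩ :=
    exists_latticeIsometry_cubic_sorted A B C hA hB hC (g₁ ν) ha₁ hb₁ hc₁
  -- Step 3: `−1 ∘ r_t ∘ r_{u−v}` flips the sign of `A` only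
  obtain ⟨-, -, ⟨htΛ, htn⟩, ⟨huvΛ, huvn⟩, -, -⟩ := bond_mem_and_norm
  set g₃ : EuclideanSpace ℝ (Fin 3) ≃ₗᵢ[ℝ] EuclideanSpace ℝ (Fin 3) :=
    (((ℝ ∙ (barlowPos 1 (Real.sqrt (2 / 3)) constHagg 0 1 0 -
        barlowPos 1 (Real.sqrt (2 / 3)) constHagg 0 0 1))ᗮ.reflection).trans
      ((ℝ ∙ barlowPos 1 (Real.sqrt (2 / 3)) constHagg 1 0 0)ᗮ.reflection)).trans
      (LinearIsometryEquiv.neg ℝ) with hg₃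
  have hG₃ := latticeIsometry_trans
    (latticeIsometry_trans (latticeIsometry_bondReflection huvΛ huvn)
      (latticeIsometry_bondReflection htΛ htn)) latticeIsometry_neg
  set y := g₂ (g₁ ν) with hy
  have act₃ : A (g₃ y) = -A y ∧ B (g₃ y) = B y ∧ C (g₃ y) = C y := by
    obtain ⟨-, -, -, ⟨e1, e2, e3⟩, -, -, -⟩ := cubic_actions A B C hA hB hC y
    set y' := (ℝ ∙ (barlowPos 1 (Real.sqrt (2 / 3)) constHagg 0 1 0 -
        barlowPos 1 (Real.sqrt (2 / 3)) constHagg 0 0 1))ᗮ.reflection y with hy'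
    obtain ⟨-, -, ⟨f1, f2, f3⟩, -, -, -, -⟩ := cubic_actions A B C hA hB hC y'
    set y'' := (ℝ ∙ barlowPos 1 (Real.sqrt (2 / 3)) constHagg 1 0 0)ᗮ.reflection y' with hy''
    obtain ⟨-, -, -, -, -, -, ⟨k1, k2, k3⟩⟩ := cubic_actions A B C hA hB hC y''
    have hg₃y : g₃ y = LinearIsometryEquiv.neg ℝ y'' := by
      rw [hg₃, LinearIsometryEquiv.trans_apply, LinearIsometryEquiv.trans_apply]
    rw [hg₃y, k1, k2, k3, f1, f2, f3, e1, e2, e3]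
    exact ⟨rfl, by ring, by ring⟩
  refine ⟨(g₁.trans g₂).trans g₃, latticeIsometry_trans (latticeIsometry_trans hG₁ hG₂) hG₃, ?_⟩
  have hgy : ((g₁.trans g₂).trans g₃) ν = g₃ y := rfl
  rw [hgy]
  obtain ⟨m1, m2, m3⟩ := act₃
  have e1 := hA (g₃ y)
  have e2 := hB (g₃ y)
  have e3 := hC (g₃ y)
  refine ⟨?_, ?_, ?_⟩
  · -- `0 ≤ ν₀` ⟸ `−A ≤ B`
    have : -A (g₃ y) ≤ B (g₃ y) := by rw [m1, m2]; linarith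
    linarith [this, e1, e2]
  · -- `ν₀ ≤ √3 ν₁` ⟸ `B ≤ C`
    have : B (g₃ y) ≤ C (g₃ y) := by rw [m2, m3]; exact hbc₂
    rw [e2, e3] at this
    nlinarith [this, h3, h3pos]
  · -- `ν₀ + (√3/3)ν₁ ≤ √(2/3)ν₂` ⟸ `A ≤ 0`
    have : A (g₃ y) ≤ 0 := by rw [m1]; linarith
    linarith [this, e1]

/-- **`NoReconstructionGain` from its restriction to the fundamental triangle.**  If there are
constants `R > 0`, `C` such that the body of the crux holds at every unit normal `ν` with
`0 ≤ ν₀`, `ν₀ ≤ √3 ν₁`, `ν₀ + (√3/3) ν₁ ≤ √(2/3) ν₂` (the spherical triangle with vertices the basal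
normal `e₃`, the bond direction `(1/2, √3/6, √(2/3))` and the cube normal `(0, √6/3, √3/3)`), then
`NoReconstructionGain` holds. -/
theorem noReconstructionGain_of_chamber :
    (∃ R C : ℝ, 0 < R ∧ ∀ ν : EuclideanSpace ℝ (Fin 3), ‖ν‖ = 1 →
      0 ≤ ν 0 → ν 0 ≤ Real.sqrt 3 * ν 1 → ν 0 + Real.sqrt 3 / 3 * ν 1 ≤ Real.sqrt (2 / 3) * ν 2 →
      ∀ ρ : ℝ, R ≤ ρ → ∀ (N : ℕ) (x : Fin N → EuclideanSpace ℝ (Fin 3)),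
        Summit.Ventures.Crystal3D.IsUnitPacking x →
        (∀ p ∈ Literature.MathematicalPhysics.StatisticalMechanics.fccStacking 1 (Real.sqrt (2 / 3)),
            -(2 * R) ≤ ⟪p, ν⟫_ℝ → ⟪p, ν⟫_ℝ ≤ -R → ‖p‖ ^ 2 - ⟪p, ν⟫_ℝ ^ 2 ≤ ρ ^ 2 → ∃ i, x i = p) →
          2 * (Real.sqrt 2 / 4 *
                ∑ᶠ w ∈ {w ∈ Literature.MathematicalPhysics.StatisticalMechanics.fccStacking 1
                  (Real.sqrt (2 / 3)) | ‖w‖ = 1}, |⟪w, ν⟫_ℝ|) *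
              Real.pi * ρ ^ 2 - C * ρ ≤
            6 * (N : ℝ) - (Summit.Ventures.Crystal3D.numContacts x : ℝ)) →
    Summit.Ventures.Crystal3D.Theses.StickyWulffConstant.NoReconstructionGain := by
  rintro ⟨R, C, hR, h⟩
  refine ⟨R, C, hR, fun ν hν => ?_⟩
  obtain ⟨g, ⟨hg, hg'⟩, h0, h1, h2⟩ := exists_latticeIsometry_mem_chamber ν
  have hgν : ‖g ν‖ = 1 := by rw [LinearIsometryEquiv.norm_map, hν]
  have hT := h (g ν) hgν h0 h1 h2
  have hback := noReconstructionGainAt_transport g.symm hg'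
    (fun p hp => by rw [LinearIsometryEquiv.symm_symm]; exact hg p hp) (g ν) R C hT
  rw [LinearIsometryEquiv.symm_apply_apply] at hback
  exact hback

/-- **The registered atom from its restriction to the fundamental triangle.**  If there are
constants `R ≥ 1`, `C` such that the atom (`#cross(P, X∖P) ≤ contactDeficiency (X∖P) + C ρ` for every
finite unit packing `X ⊇ P`, `P` the `ν`-slab sample of radius `ρ ≥ R`) holds at every unit normal of
the triangle, then it holds at every unit normal (the signature of `stub_adhesion`). -/
theorem adhesion_of_chamber :
    (∃ R C : ℝ, 1 ≤ R ∧ ∀ ν : EuclideanSpace ℝ (Fin 3), ‖ν‖ = 1 →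
      0 ≤ ν 0 → ν 0 ≤ Real.sqrt 3 * ν 1 → ν 0 + Real.sqrt 3 / 3 * ν 1 ≤ Real.sqrt (2 / 3) * ν 2 →
      ∀ ρ : ℝ, R ≤ ρ → ∀ X P : Finset (EuclideanSpace ℝ (Fin 3)),
      (∀ p ∈ X, ∀ q ∈ X, p ≠ q → 1 ≤ dist p q) → P ⊆ X →
      (∀ p, p ∈ P ↔ (p ∈ Literature.MathematicalPhysics.StatisticalMechanics.fccStacking 1
        (Real.sqrt (2 / 3)) ∧ -(2 * R) ≤ ⟪p, ν⟫_ℝ ∧ ⟪p, ν⟫_ℝ ≤ -R ∧ ‖p‖ ^ 2 - ⟪p, ν⟫_ℝ ^ 2 ≤ ρ ^ 2)) →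
      ((((P ×ˢ (X \ P)).filter fun pq => dist pq.1 pq.2 = 1).card : ℕ) : ℝ) ≤
        Literature.MathematicalPhysics.StatisticalMechanics.contactDeficiency (X \ P) + C * ρ) →
    ∃ R C : ℝ, 1 ≤ R ∧ ∀ ν : EuclideanSpace ℝ (Fin 3), ‖ν‖ = 1 → ∀ ρ : ℝ, R ≤ ρ →
      ∀ X P : Finset (EuclideanSpace ℝ (Fin 3)),
      (∀ p ∈ X, ∀ q ∈ X, p ≠ q → 1 ≤ dist p q) → P ⊆ X →
      (∀ p, p ∈ P ↔ (p ∈ Literature.MathematicalPhysics.StatisticalMechanics.fccStacking 1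
        (Real.sqrt (2 / 3)) ∧ -(2 * R) ≤ ⟪p, ν⟫_ℝ ∧ ⟪p, ν⟫_ℝ ≤ -R ∧ ‖p‖ ^ 2 - ⟪p, ν⟫_ℝ ^ 2 ≤ ρ ^ 2)) →
      ((((P ×ˢ (X \ P)).filter fun pq => dist pq.1 pq.2 = 1).card : ℕ) : ℝ) ≤
        Literature.MathematicalPhysics.StatisticalMechanics.contactDeficiency (X \ P) + C * ρ := by
  rintro ⟨R, C, hR, h⟩
  refine ⟨R, C, hR, fun ν hν ρ hρ => ?_⟩
  obtain ⟨g, ⟨hg, hg'⟩, h0, h1, h2⟩ := exists_latticeIsometry_mem_chamber ν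
  have hgν : ‖g ν‖ = 1 := by rw [LinearIsometryEquiv.norm_map, hν]
  have hT := h (g ν) hgν h0 h1 h2 ρ hρ
  have hback := adhesion_transport g.symm hg'
    (fun p hp => by rw [LinearIsometryEquiv.symm_symm]; exact hg p hp) (g ν) R C ρ hT
  rw [LinearIsometryEquiv.symm_apply_apply] at hback
  exact hback

end Summit.Ventures.Crystal3D.Theorems
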